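import Mathlib
import HarnessLib

/-!
# `MatrixDescartes` census — rank-one `(2,4)₁`, chamber (C): THE CHORD LEMMA WITHOUT THE RATIO HYPOTHESIS `ρ ≤ R`

HONEST FRAMING.  Object-search cell `pub-symmetroid`, seat `val-sym-mdr-p1` (generation 26); helper file `--supports` the crux item
stmt-ValiantsHypothesis-18050 (`Theses.LacunarySymmetroid.MatrixDescartes`, OPEN, on HOLD) with NO closure claim.  Same lemma as
`…OneThreeSupportKit.chord_contradiction_general` WITHOUT the hypothesis `ρ ≤ R` (`chord_contradiction_free`): in the case `t₁ ≤ t₀` the bound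
`(t₀ − t₂)² ≤ (ρt₀)²` replaces `(t₀ − t₂)² ≤ t₀²`, so both cases end in `KC(R−1)² ≤ ρ³R²`; needed for the 14 of 203 worklist supports whose
close-letters constant `KB` is large (seat exp/support_worklist_d30.tsv, rows marked TUNE).  Elementary real inequality,
the reusable last step of the support-by-support certificates «never Descartes-sharp ⇒ Z₊ ≤ 7» for all-core rank-one pencils in chamber (C)
of the `1|3` split (first instance: `…OneThreeSupportSixSeven`, support `(6; 0, 10, 14, 19)`, with the constants `57, 9/25, 9` hard-wired in
its `chord_contradiction`).  THE LEMMA (`chord_contradiction_general`): for positive positions `t₀, t₁, t₂` the three chord inequalities that the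
three Farkas rays of the Newton-cone rows produce — `KA·t₀t₁ ≤ (t₀−t₁)²` (letters 0, 1 far), `(t₁−t₂)² ≤ KB·t₁t₂` (letters 1, 2 close),
`KC·(t₀−t₁)²t₂ ≤ (t₀−t₂)²t₁` (chord 0,2 against chord 0,1) — are incompatible as soon as there are numbers `R ≥ ρ ≥ 1` with
`(R−1)² ≤ KA·R`, `KB·ρ ≤ (ρ−1)²` and `ρ³R² < KC·(R−1)²` (then `max/min(t₀,t₁) ≥ R`, `t₂/t₁ ∈ [1/ρ, ρ]`, and the ratio of chords is at most
`ρ³R²/(R−1)²`).  Per support only three rational constants and three `norm_num` facts remain (seat generator `work/gen_support*.py`; located: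
the criterion closes all 203 integer supports of chamber (C) with `d₀ = 0`, `d₃ ≤ 30`, seat exp/scan3ray.py — a typer-sized table, NOT claimed
here).  Nothing here bears on `MatrixDescartes` in its window, on `DoorA26` / `DoorA34`, registers / credences, or `VP ≠ VNP`.

[folklore] Elementary inequalities (`nlinarith` on explicit factorizations `ρ(t₁−t₂)² − (ρ−1)²t₁t₂ = (ρt₁−t₂)(t₁−ρt₂)`).  No definitions,
no named facts.
-/

-- `Summit.ValiantsHypothesis.ValiantsHypothesis.…` repeats a component by the D-0017 layout
-- (single-conjunct summit), which the `dupNamespace` linter flags; the name is mandated.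
set_option linter.dupNamespace false

namespace Summit.ValiantsHypothesis.ValiantsHypothesis.Theorems.LacunarySymmetroidMatrixDescartes.Pivot.TwoDirections.BlockLaw

/-- **THE CHORD LEMMA without `ρ ≤ R`.**  Positive `t₀, t₁, t₂`; `KA·t₀t₁ ≤ (t₀−t₁)²`, `(t₁−t₂)² ≤ KB·t₁t₂`, `KC·(t₀−t₁)²·t₂ ≤ (t₀−t₂)²·t₁`; constants
with `0 < KA`, `1 ≤ R`, `(R−1)² ≤ KA·R`, `1 ≤ ρ`, `KB·ρ ≤ (ρ−1)²`, `ρ³R² < KC(R−1)²` ⇒ `False`. [folklore] -/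
theorem chord_contradiction_free (t₀ t₁ t₂ KA KB KC R ρ : ℝ) (ht₀ : 0 < t₀) (ht₁ : 0 < t₁) (ht₂ : 0 < t₂)
    (hKA : 0 < KA) (hR : 1 ≤ R) (hRA : (R - 1) ^ 2 ≤ KA * R) (hρ : 1 ≤ ρ) (hρB : KB * ρ ≤ (ρ - 1) ^ 2)
    (hKC : ρ ^ 3 * R ^ 2 < KC * (R - 1) ^ 2)
    (hA : KA * (t₀ * t₁) ≤ (t₀ - t₁) ^ 2) (hB : (t₁ - t₂) ^ 2 ≤ KB * (t₁ * t₂))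
    (hC : KC * ((t₀ - t₁) ^ 2 * t₂) ≤ (t₀ - t₂) ^ 2 * t₁) : False := by
  have hKC0 : 0 < KC := by
    have h1 : 0 < ρ ^ 3 * R ^ 2 := by positivity
    exact pos_of_mul_pos_left (lt_trans h1 hKC) (sq_nonneg _)
  have a1 : t₁ ≤ ρ * t₁ := le_mul_of_one_le_left ht₁.le hρ
  have a2 : t₂ ≤ ρ * t₂ := le_mul_of_one_le_left ht₂.le hρ
  -- (1) letters 1, 2 close: t₂ ≤ ρ t₁ and t₁ ≤ ρ t₂
  have key : (ρ * t₁ - t₂) * (t₁ - ρ * t₂) ≤ 0 := by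
    have e : (ρ * t₁ - t₂) * (t₁ - ρ * t₂) = ρ * (t₁ - t₂) ^ 2 - (ρ - 1) ^ 2 * (t₁ * t₂) := by ring
    rw [e]
    nlinarith [mul_le_mul_of_nonneg_left hB (by linarith : (0 : ℝ) ≤ ρ),
      mul_le_mul_of_nonneg_right hρB (mul_pos ht₁ ht₂).le]
  have hU : t₂ ≤ ρ * t₁ := by
    by_contra h
    push Not at h
    have hneg : ρ * t₁ - t₂ < 0 := by linarith
    have h2 : 0 ≤ t₁ - ρ * t₂ := by
      by_contra h'
      push Not at h'
      nlinarith [mul_pos_of_neg_of_neg hneg h']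
    linarith
  have hL : t₁ ≤ ρ * t₂ := by
    by_contra h
    push Not at h
    have hpos' : 0 < t₁ - ρ * t₂ := by linarith
    have h2 : ρ * t₁ - t₂ ≤ 0 := by
      by_contra h'
      push Not at h'
      nlinarith [mul_pos h' hpos']
    linarith
  -- (2) letters 0, 1 far
  have keyA : 0 ≤ (R * t₀ - t₁) * (t₀ - R * t₁) := by
    have e : (R * t₀ - t₁) * (t₀ - R * t₁) = R * (t₀ - t₁) ^ 2 - (R - 1) ^ 2 * (t₀ * t₁) := by ring
    rw [e]
    nlinarith [mul_le_mul_of_nonneg_left hA (by linarith : (0 : ℝ) ≤ R),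
      mul_le_mul_of_nonneg_right hRA (mul_pos ht₀ ht₁).le]
  have hne : t₀ ≠ t₁ := by
    intro h
    rw [h] at hA
    have : 0 < KA * (t₁ * t₁) := by positivity
    nlinarith
  have b0 : t₀ ≤ R * t₀ := le_mul_of_one_le_left ht₀.le hR
  have b1 : t₁ ≤ R * t₁ := le_mul_of_one_le_left ht₁.le hR
  rcases le_or_gt t₁ t₀ with h10 | h10
  · -- t₁ ≤ t₀, so t₀ ≥ R t₁
    have hlt : t₁ < t₀ := lt_of_le_of_ne h10 (Ne.symm hne)
    have hpos : 0 < R * t₀ - t₁ := by linarith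
    have hR0 : R * t₁ ≤ t₀ := by
      by_contra h
      push Not at h
      nlinarith [mul_pos hpos (by linarith : 0 < R * t₁ - t₀)]
    have h1 : (R - 1) * t₀ ≤ R * (t₀ - t₁) := by linarith
    have h1' : ((R - 1) * t₀) ^ 2 ≤ (R * (t₀ - t₁)) ^ 2 :=
      pow_le_pow_left₀ (mul_nonneg (by linarith) ht₀.le) h1 2
    have b0' : t₀ ≤ ρ * t₀ := le_mul_of_one_le_left ht₀.le hρ
    have hU' : t₂ ≤ ρ * t₀ := le_trans hU (mul_le_mul_of_nonneg_left h10 (by linarith))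
    have h2 : (t₀ - t₂) ^ 2 ≤ (ρ * t₀) ^ 2 := sq_le_sq' (by linarith) (by linarith)
    have c1 : KC * ((R - 1) ^ 2 * t₀ ^ 2) * t₂ ≤ KC * (R ^ 2 * (t₀ - t₁) ^ 2) * t₂ := by
      have : (R - 1) ^ 2 * t₀ ^ 2 ≤ R ^ 2 * (t₀ - t₁) ^ 2 := by
        have e1 : (R - 1) ^ 2 * t₀ ^ 2 = ((R - 1) * t₀) ^ 2 := by ring
        have e2 : R ^ 2 * (t₀ - t₁) ^ 2 = (R * (t₀ - t₁)) ^ 2 := by ring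
        rw [e1, e2]; exact h1'
      exact mul_le_mul_of_nonneg_right (mul_le_mul_of_nonneg_left this hKC0.le) ht₂.le
    have c2 : KC * (R ^ 2 * (t₀ - t₁) ^ 2) * t₂ ≤ R ^ 2 * ((ρ * t₀) ^ 2 * t₁) := by
      have c2a : R ^ 2 * (KC * ((t₀ - t₁) ^ 2 * t₂)) ≤ R ^ 2 * ((t₀ - t₂) ^ 2 * t₁) :=
        mul_le_mul_of_nonneg_left hC (sq_nonneg R)
      have c2b : R ^ 2 * ((t₀ - t₂) ^ 2 * t₁) ≤ R ^ 2 * ((ρ * t₀) ^ 2 * t₁) :=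
        mul_le_mul_of_nonneg_left (mul_le_mul_of_nonneg_right h2 ht₁.le) (sq_nonneg R)
      have e : KC * (R ^ 2 * (t₀ - t₁) ^ 2) * t₂ = R ^ 2 * (KC * ((t₀ - t₁) ^ 2 * t₂)) := by ring
      rw [e]; exact c2a.trans c2b
    have c3 : R ^ 2 * ((ρ * t₀) ^ 2 * t₁) ≤ R ^ 2 * ((ρ * t₀) ^ 2 * (ρ * t₂)) :=
      mul_le_mul_of_nonneg_left (mul_le_mul_of_nonneg_left hL (sq_nonneg (ρ * t₀))) (sq_nonneg R)
    have c4 : KC * (R - 1) ^ 2 * (t₀ ^ 2 * t₂) ≤ ρ ^ 3 * R ^ 2 * (t₀ ^ 2 * t₂) := by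
      have h := c1.trans (c2.trans c3)
      calc KC * (R - 1) ^ 2 * (t₀ ^ 2 * t₂) = KC * ((R - 1) ^ 2 * t₀ ^ 2) * t₂ := by ring
        _ ≤ R ^ 2 * ((ρ * t₀) ^ 2 * (ρ * t₂)) := h
        _ = ρ ^ 3 * R ^ 2 * (t₀ ^ 2 * t₂) := by ring
    have hpos2 : 0 < t₀ ^ 2 * t₂ := by positivity
    have c5 : KC * (R - 1) ^ 2 ≤ ρ ^ 3 * R ^ 2 := le_of_mul_le_mul_right c4 hpos2
    linarith
  · -- t₀ < t₁, so t₁ ≥ R t₀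
    have hpos : 0 < R * t₁ - t₀ := by linarith
    have hR0 : R * t₀ ≤ t₁ := by
      by_contra h
      push Not at h
      nlinarith [mul_pos (by linarith : 0 < R * t₀ - t₁) hpos]
    have h1 : (R - 1) * t₁ ≤ R * (t₁ - t₀) := by linarith
    have h1' : ((R - 1) * t₁) ^ 2 ≤ (R * (t₁ - t₀)) ^ 2 :=
      pow_le_pow_left₀ (mul_nonneg (by linarith) ht₁.le) h1 2
    have ht01 : t₀ ≤ ρ * t₁ := le_trans h10.le a1
    have h2 : (t₀ - t₂) ^ 2 ≤ (ρ * t₁) ^ 2 := by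
      apply sq_le_sq'
      · linarith
      · linarith
    have c1 : KC * ((R - 1) ^ 2 * t₁ ^ 2) * t₂ ≤ KC * (R ^ 2 * (t₀ - t₁) ^ 2) * t₂ := by
      have : (R - 1) ^ 2 * t₁ ^ 2 ≤ R ^ 2 * (t₀ - t₁) ^ 2 := by
        have e1 : (R - 1) ^ 2 * t₁ ^ 2 = ((R - 1) * t₁) ^ 2 := by ring
        have e2 : R ^ 2 * (t₀ - t₁) ^ 2 = (R * (t₁ - t₀)) ^ 2 := by ring
        rw [e1, e2]; exact h1'
      exact mul_le_mul_of_nonneg_right (mul_le_mul_of_nonneg_left this hKC0.le) ht₂.le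
    have c2 : KC * (R ^ 2 * (t₀ - t₁) ^ 2) * t₂ ≤ R ^ 2 * ((ρ * t₁) ^ 2 * t₁) := by
      have c2a : R ^ 2 * (KC * ((t₀ - t₁) ^ 2 * t₂)) ≤ R ^ 2 * ((t₀ - t₂) ^ 2 * t₁) :=
        mul_le_mul_of_nonneg_left hC (sq_nonneg R)
      have c2b : R ^ 2 * ((t₀ - t₂) ^ 2 * t₁) ≤ R ^ 2 * ((ρ * t₁) ^ 2 * t₁) :=
        mul_le_mul_of_nonneg_left (mul_le_mul_of_nonneg_right h2 ht₁.le) (sq_nonneg R)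
      have e : KC * (R ^ 2 * (t₀ - t₁) ^ 2) * t₂ = R ^ 2 * (KC * ((t₀ - t₁) ^ 2 * t₂)) := by ring
      rw [e]; exact c2a.trans c2b
    have c3 : R ^ 2 * ((ρ * t₁) ^ 2 * t₁) ≤ R ^ 2 * ((ρ * t₁) ^ 2 * (ρ * t₂)) :=
      mul_le_mul_of_nonneg_left (mul_le_mul_of_nonneg_left hL (sq_nonneg (ρ * t₁))) (sq_nonneg R)
    have c4 : KC * (R - 1) ^ 2 * (t₁ ^ 2 * t₂) ≤ ρ ^ 3 * R ^ 2 * (t₁ ^ 2 * t₂) := by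
      have h := c1.trans (c2.trans c3)
      calc KC * (R - 1) ^ 2 * (t₁ ^ 2 * t₂) = KC * ((R - 1) ^ 2 * t₁ ^ 2) * t₂ := by ring
        _ ≤ R ^ 2 * ((ρ * t₁) ^ 2 * (ρ * t₂)) := h
        _ = ρ ^ 3 * R ^ 2 * (t₁ ^ 2 * t₂) := by ring
    have hpos2 : 0 < t₁ ^ 2 * t₂ := by positivity
    have c5 : KC * (R - 1) ^ 2 ≤ ρ ^ 3 * R ^ 2 := le_of_mul_le_mul_right c4 hpos2
    linarith

end Summit.ValiantsHypothesis.ValiantsHypothesis.Theorems.LacunarySymmetroidMatrixDescartes.Pivot.TwoDirections.BlockLaw
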